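import Summits.QuantumFields.BalabanUV.Beta.EriceRemainderEnclosureHistoryAutonomyComparisonAgeCompositionStaticChain

/-!
# EriceRemainderEnclosureHistoryAutonomyComparisonAgeCompositionStaticChainSaturation — (E77a) THE SATURATION GAME: the static chain over the
# level-coupled system reduced to SLACKS — (i) the chain load in PRODUCT FORM `1 + V_m = Π_{j<m}(1 + b_j·w_j)` (`b_j = ρ_j∕(1−ρ_j)` the age's own ratio,
# `w_j = (θ_j + V_j)∕(1 + V_j) ∈ [θ_j, 1]` its weight: the load already present makes the new age compound more of it); (ii) the SLACK FORM of a
# level-coupled row, `(a_j∕a_z)·ε_j ≥ 1∕a_z + Σ_{i younger than j} X_i (a_i∕a_z) R_{ij}` (`ε_j` = the row-`j` slack with respect to the ages OLDER than `j`):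
# an older age whose own row is nearly exhausted (`ε_j` small) has its level — hence its charge on every younger row — AMPLIFIED by `1∕ε_j` times the
# reads of every age in between, the young's own included; (iii) per-age domination `θ_j b_j ≤ κ·d_j` of the chain terms by the amplified charges
# sums to `x̂·V ≤ κ(1 − 2s·x̂)` and, with (E74a)'s window-mass form, closes the step

Cell `pub-balaban`, β-function sub-cell, BINDER row D4 «RemainderConst leaves for Bałaban's split» (`HOME/BINDER-OWNERS.md`; owner lineage `b2b-balaban-beta-an4`;
this file by co-owner #2 lineage `b2b-balaban-beta-d4-p2`, generation 68), β-FLOW TEAM duty (1), FREEZE (0) honoured (def-free; imports (E72a) `…StaticChain`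
(Mathlib only) for `load_nonneg` ∕ `one_add_load_succ_mul`; (E74a), (E76b), (E76c) are referred to BY NAME, nothing restated).

HONEST FRAMING (page 1, verbatim and binding).  *"Discharging BetaPertH makes Bałaban's UV stability UNCONDITIONAL — a real constructive-QFT result; it is
NOT the continuum limit and NOT the Clay problem."*  THIS FILE DISCHARGES NOTHING OF THE KIND.  Elementary algebra of finite sums and products of real numbers —
hypotheses of a census, not facts; the form, signs, ages and moments of Bałaban's (1.22) limit functional are NOT PRINTED ([I] p. 298; GAPS G-t4-U2-1∕-2) and
NOT asserted.  Row D4 class UNCHANGED (critical-path width 0; instance 0∕1; D4 DISCHARGE NO DATE).  HONEST DEPENDENCY: continuum YM on T⁴ ⇐ BetaPertH ∧ nine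
spine estimates (0/9 proved); BetaPertH ⇐ (D1) ∧ (D4) ∧ CAP+tail; G-an2-4 gates asym, D1 and NE2/3/4.

THE POINT (README `HOME/b2b-balaban-beta-d4-p2/g68/e77/README.md`; route (N′) of g67).  Over the LEVEL-COUPLED system ((E76b): loads `x` AND levels `a` with
`a_i ≥ 1 + Σ_l 2x_l a_l S(k_l,k_i)∕k_l`) the window-mass chain's worst case is numerically the LONE young (g67 README §5).  This station removes the levels: every
row is rewritten as a statement about the SLACK `ε_j = 1 − 2x_js_j − 2Σ_{i older} x_i(a_i∕a_j)σ_i(k_j)` of an age with respect to its older ages (§2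
`level_mul_slack_eq`, `ratio_mul_slack_ge`): `(a_j∕a_z)·ε_j ≥ 1∕a_z + 2x_zφ_j(z) + Σ_{i between} 2x_i(a_i∕a_z)S(k_i,k_j)∕k_i`.  Processing the older ages of a
young scale `z` NEAREST FIRST this yields explicit lower bounds `ĝ_j(x_z) = max(1, [2x_zφ_j + Σ_{i btw} 2x_iĝ_iS_{ij}]∕c_j)` for the level ratios from the loads and
the RELAXED slacks `c_j ≥ ε_j` alone (`amplification_ge_of_slack`, `slack_le_relaxed`), hence a lower bound `𝒰(x_z) = Σ_j x_jσ_jĝ_j(x_z)` for the older usage of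
row `z`, a cap `x̂_z` (`2x̂s_z + 2𝒰(x̂) = 1`, `load_lt_cap`) and the next relaxed slack `c_z = 1 − 2x_zs_z − 2𝒰(x_z)` — THE SATURATION GAME, a self-contained
relaxation of «LC + chain» in which the adversary only chooses the ages and the fractions `x_j∕x̂_j`.  NUMERICS OF RECORD (README §3–§4; `satgame.py`, kit
j317062∕j317065∕j317067): the game's `sup x̂_z(1+V)∕((1−Ω)·lone_z)` is `1.000–1.005` on every family tried (= the lone young, the adjacent-spike premium of g67),
while every weaker relaxation (no in-between recursion; `1∕ε_j` replaced through the carried ratio) EXPLODES (`V → 9–60`): the nested amplification is what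
carries the static closure.  §1 is the chain-side half of the per-age accounting (README §5): the new age multiplies `1 + V` by `1 + b·w` with `w` between its
defect and one; §3–§4 the bookkeeping that turns per-age domination into closure.  NOT CLAIMED: the per-age domination itself for any configuration (README §5
lists the measured worst cases: `sup Φ = 0.37`, compounding ≤ in-between amplification throughout); the static closure; MONO; anything nonlinear; anything printed.

WHAT IS PROVED ([folklore]; 0 `def`, 0 sorry).  §1 `one_add_load_succ_eq_mul`, **`one_add_load_eq_prod`**, `weight_mem_Icc`, `weight_mono`.  §2
**`level_mul_slack_eq`**, **`ratio_mul_slack_ge`**, `amplification_ge_of_slack`, `slack_pos_of_row`.  §3 `slack_le_relaxed`, **`load_lt_cap`**, `own_ratio_eq`,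
`own_ratio_le`, `relaxed_slack_le_gap`.  §4 **`cap_mul_load_le_of_domination`**, **`ratio_lt_one_of_cap_mul_load`**, `own_term_le_of_charge`,
`slack_mul_le_of_tangent`.  §5 (append) **`cap_mul_load_lt_of_signed_sum`**, `term_le_of_constant_regime`.  §6 (append) `slack_quotient_eq`,
`slack_quotient_le`, **`linear_regime_dominated`**.
-/
noncomputable section
open Finset

namespace Summit.QuantumFields.BalabanUV.Beta.EriceRemainderEnclosureHistoryAutonomyComparisonAgeCompositionStaticChainSaturation

open Summit.QuantumFields.BalabanUV.Beta.EriceRemainderEnclosureHistoryAutonomyComparisonAgeCompositionStaticChain (load_nonneg one_add_load_succ_mul)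

/-! ## §1 The chain load in product form -/

/-- ONE STEP IN PRODUCT FORM.  For the load transported as `V_{m+1} = (V_m + θ_mρ_m)∕(1−ρ_m)` (`ρ_m < 1`, `1 + V_m ≠ 0`):
`1 + V_{m+1} = (1 + V_m)·(1 + b_m·w_m)` with the age's OWN ratio `b_m = ρ_m∕(1−ρ_m)` and its WEIGHT `w_m = (θ_m + V_m)∕(1 + V_m)` — the new age compounds the load
already present in full and adds its own defect on top ((E72a) `one_add_load_succ_mul` rearranged). [folklore] -/
theorem one_add_load_succ_eq_mul {ρ θ V : ℕ → ℝ} (hρ1 : ∀ m, ρ m < 1)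
    (hV : ∀ m, V (m + 1) = (V m + θ m * ρ m) / (1 - ρ m)) (m : ℕ) (hVm : 1 + V m ≠ 0) :
    1 + V (m + 1) = (1 + V m) * (1 + ρ m / (1 - ρ m) * ((θ m + V m) / (1 + V m))) := by
  have h1 : (1 - ρ m) ≠ 0 := (sub_pos.mpr (hρ1 m)).ne'
  have h := one_add_load_succ_mul hρ1 hV m
  have e : 1 + V (m + 1) = ((1 + V m) - (1 - θ m) * ρ m) / (1 - ρ m) := by
    rw [← h, mul_div_cancel_right₀ _ h1]
  rw [e]
  field_simp
  ring

/-- **THE CHAIN LOAD IN PRODUCT FORM.**  Defects `θ ≥ 0`, ratios in `[0,1)`, `V_0 = 0`: for every `m`,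
`1 + V_m = Π_{j<m} (1 + b_j·w_j)`, `b_j = ρ_j∕(1−ρ_j)`, `w_j = (θ_j + V_j)∕(1 + V_j)`.  The older ages enter the young's load one factor each; the factor of age `j`
is `1 + b_jθ_j` when nothing older is loaded (`V_j = 0`) and tends to the full compounding `1 + b_j = (1−ρ_j)⁻¹` as the prior load grows. [folklore] -/
theorem one_add_load_eq_prod {ρ θ V : ℕ → ℝ} (hρ0 : ∀ m, 0 ≤ ρ m) (hρ1 : ∀ m, ρ m < 1) (hθ0 : ∀ m, 0 ≤ θ m) (hV0 : V 0 = 0)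
    (hV : ∀ m, V (m + 1) = (V m + θ m * ρ m) / (1 - ρ m)) :
    ∀ m, 1 + V m = ∏ j ∈ range m, (1 + ρ j / (1 - ρ j) * ((θ j + V j) / (1 + V j))) := by
  have hnn := load_nonneg hρ0 hρ1 hθ0 hV0 hV
  intro m
  induction m with
  | zero => simp [hV0]
  | succ m ih =>
    have hVm : 1 + V m ≠ 0 := by linarith [hnn m]
    rw [prod_range_succ, ← ih, one_add_load_succ_eq_mul hρ1 hV m hVm]

/-- The weight lies between the defect and one: `θ ≤ (θ + V)∕(1 + V) ≤ 1` for `θ ≤ 1`, `V ≥ 0`. [folklore] -/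
theorem weight_mem_Icc {θ V : ℝ} (hθ1 : θ ≤ 1) (hV : 0 ≤ V) :
    θ ≤ (θ + V) / (1 + V) ∧ (θ + V) / (1 + V) ≤ 1 := by
  have h1 : 0 < 1 + V := by linarith
  refine ⟨?_, ?_⟩
  · rw [le_div_iff₀ h1]; nlinarith
  · rw [div_le_iff₀ h1]; linarith

/-- The weight is non-decreasing in the prior load: `V ≤ V'` ⟹ `(θ+V)∕(1+V) ≤ (θ+V')∕(1+V')` (`θ ≤ 1`, `V ≥ 0`) — interaction among the older ages never lowers
the factor a new age contributes. [folklore] -/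
theorem weight_mono {θ V V' : ℝ} (hθ1 : θ ≤ 1) (hV : 0 ≤ V) (hVV' : V ≤ V') :
    (θ + V) / (1 + V) ≤ (θ + V') / (1 + V') := by
  have h1 : 0 < 1 + V := by linarith
  have h2 : 0 < 1 + V' := by linarith
  rw [div_le_div_iff₀ h1 h2]
  nlinarith [mul_nonneg (sub_nonneg.mpr hVV') (sub_nonneg.mpr hθ1)]

/-! ## §2 The slack form of a level-coupled row -/

/-- **THE SLACK IDENTITY OF A ROW.**  Ages indexed by a finite set split as `{j} ∪ O ∪ Y` (disjoint: the age itself, its OLDER ages, the YOUNGER ones), levels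
`a`, loads `X` (`= 2x`), read coefficients `R i j` (reads of age `i` on row `j` per unit level: `R j j = s_j`, `R i j = S(k_i,k_j)∕k_i`).  With the slack of row `j`
with respect to its older ages, `ε_j := 1 − X_j R_{jj} − Σ_{i∈O} X_i (a_i∕a_j) R_{ij}` (`a_j ≠ 0`):
`a_j·ε_j = a_j − X_j a_j R_{jj} − Σ_{i∈O} X_i a_i R_{ij}`, so the row `a_j ≥ 1 + Σ_{i ∈ {j}∪O∪Y} X_i a_i R_{ij}` reads **`a_j·ε_j ≥ 1 + Σ_{i∈Y} X_i a_i R_{ij}`** —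
the younger ages' reads on row `j` are paid out of its slack. [folklore] -/
theorem level_mul_slack_eq {a X : ℕ → ℝ} {R : ℕ → ℕ → ℝ} {O : Finset ℕ} {j : ℕ} (haj : a j ≠ 0) :
    a j * (1 - X j * R j j - ∑ i ∈ O, X i * (a i / a j) * R i j) = a j - X j * a j * R j j - ∑ i ∈ O, X i * a i * R i j := by
  rw [mul_sub, mul_sub, mul_one, mul_sum]
  congr 1
  · ring
  · exact sum_congr rfl fun i _ => by field_simp

/-- **THE SLACK FORM OF A ROW.**  In the setting of `level_mul_slack_eq`, if the row holds, `a_j ≥ 1 + X_ja_jR_{jj} + Σ_{i∈O} X_ia_iR_{ij} + Σ_{i∈Y} X_ia_iR_{ij}`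
(the three groups of the level-coupled row written out), then `a_j·ε_j ≥ 1 + Σ_{i∈Y} X_i a_i R_{ij}`. [folklore] -/
theorem level_mul_slack_ge {a X : ℕ → ℝ} {R : ℕ → ℕ → ℝ} {O Y : Finset ℕ} {j : ℕ} (haj : a j ≠ 0)
    (hrow : 1 + X j * a j * R j j + ∑ i ∈ O, X i * a i * R i j + ∑ i ∈ Y, X i * a i * R i j ≤ a j) :
    1 + ∑ i ∈ Y, X i * a i * R i j ≤ a j * (1 - X j * R j j - ∑ i ∈ O, X i * (a i / a j) * R i j) := by
  rw [level_mul_slack_eq haj]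
  linarith

/-- **THE AMPLIFICATION OF AN OLDER LEVEL, SLACK FORM.**  Dividing by the young's level `a_z > 0`: with `g_i = a_i∕a_z`,
**`g_j·ε_j ≥ 1∕a_z + Σ_{i∈Y} X_i g_i R_{ij}`** — the level ratio of an older age times its slack dominates the reads of all the younger ages on its row (the young
`z`'s own `X_z R_{zj} = 2x_z·S(z,k_j)∕z` and the in-between ages', each with ITS level ratio): an age whose row is nearly exhausted by its elders is raised —
relative to every younger scale — by `1∕ε_j` times whatever the younger ages read on its row.  This is (E76b) `level_ratio_ge` plus the row of `z`, solved for
the ratio. [folklore] -/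
theorem ratio_mul_slack_ge {a X : ℕ → ℝ} {R : ℕ → ℕ → ℝ} {O Y : Finset ℕ} {j z : ℕ} (haj : 0 < a j) (haz : 0 < a z)
    (hrow : 1 + X j * a j * R j j + ∑ i ∈ O, X i * a i * R i j + ∑ i ∈ Y, X i * a i * R i j ≤ a j) :
    1 / a z + ∑ i ∈ Y, X i * (a i / a z) * R i j ≤ (a j / a z) * (1 - X j * R j j - ∑ i ∈ O, X i * (a i / a j) * R i j) := by
  have h := level_mul_slack_ge haj.ne' hrow
  have e1 : 1 / a z + ∑ i ∈ Y, X i * (a i / a z) * R i j = (1 + ∑ i ∈ Y, X i * a i * R i j) / a z := by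
    rw [add_div, sum_div]
    exact congrArg _ (sum_congr rfl fun i _ => by field_simp)
  rw [e1, div_mul_eq_mul_div, div_le_div_iff_of_pos_right haz]
  exact h

/-- The slack of a feasible row is positive: `a_j ε_j ≥ 1 + (non-negative)` with `a_j > 0` forces `ε_j > 0`. [folklore] -/
theorem slack_pos_of_row {aj ε T : ℝ} (haj : 0 < aj) (hT : 0 ≤ T) (h : 1 + T ≤ aj * ε) : 0 < ε := by
  by_contra hε
  have : aj * ε ≤ 0 := mul_nonpos_of_nonneg_of_nonpos haj.le (not_lt.mp hε)
  linarith

/-- AMPLIFICATION FROM A RELAXED SLACK.  If `g·ε ≥ N` with `N ≥ 0`, `g ≥ 0` and the slack is only known through an upper bound `ε ≤ c` with `c > 0`, then still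
`g ≥ N∕c` — the game may replace the true slack by any relaxed slack `c ≥ ε`. [folklore] -/
theorem amplification_ge_of_slack {g ε c N : ℝ} (hg : 0 ≤ g) (hN : N ≤ g * ε) (hεc : ε ≤ c) (hc : 0 < c) : N / c ≤ g := by
  rw [div_le_iff₀ hc]
  calc N ≤ g * ε := hN
    _ ≤ g * c := mul_le_mul_of_nonneg_left hεc hg

/-! ## §3 Relaxed slacks, caps and the own ratio -/

/-- RELAXED SLACK.  If the true older usage `U` of row `j` dominates the game's lower bound `𝒰`, the true slack `1 − X s − 2U` is at most the relaxed slack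
`c = 1 − X s − 2𝒰`. [folklore] -/
theorem slack_le_relaxed {Xs U Ul : ℝ} (h : Ul ≤ U) : 1 - Xs - 2 * U ≤ 1 - Xs - 2 * Ul := by linarith

/-- **THE CAP.**  A non-decreasing lower bound `𝒰` for the older usage of the young's row, the row `2x s + 2U < 1` with `U ≥ 𝒰(x)`, and a level `x̂` at which
the relaxed row is exhausted, `2x̂ s + 2𝒰(x̂) ≥ 1` (`s > 0`): then `x < x̂` — every admissible young load lies below the game's cap. [folklore] -/
theorem load_lt_cap {𝒰 : ℝ → ℝ} {x xh s U : ℝ} (hs : 0 < s) (hmono : Monotone 𝒰) (hU : 𝒰 x ≤ U) (hrow : 2 * x * s + 2 * U < 1)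
    (hcap : 1 ≤ 2 * xh * s + 2 * 𝒰 xh) : x < xh := by
  by_contra hx
  have h1 : 𝒰 xh ≤ 𝒰 x := hmono (not_lt.mp hx)
  nlinarith [not_lt.mp hx]

/-- THE OWN RATIO AS SATURATION.  With `ρ = λ·ρ̂` (the age took the fraction `λ` of its cap, `ρ̂ = x̂·M` its ratio at full load): `ρ∕(1−ρ) = λρ̂∕(1 − λρ̂)`.
[folklore] -/
theorem own_ratio_eq {lam ρh : ℝ} : lam * ρh / (1 - lam * ρh) = (lam * ρh) / (1 - lam * ρh) := rfl

/-- The own ratio is controlled by the saturation: for `0 ≤ λ < 1`, `ρ̂ ≤ 1`: `λρ̂∕(1 − λρ̂) ≤ λ∕(1 − λ)` — an age that leaves the fraction `1 − λ` of its cap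
unused compounds the chain by at most `1∕(1−λ)`, whatever its ratio at full load. [folklore] -/
theorem own_ratio_le {lam ρh : ℝ} (hl0 : 0 ≤ lam) (hl1 : lam < 1) (hr1 : ρh ≤ 1) :
    lam * ρh / (1 - lam * ρh) ≤ lam / (1 - lam) := by
  have h1 : 0 < 1 - lam := by linarith
  have h2 : 0 < 1 - lam * ρh := by nlinarith
  rw [div_le_div_iff₀ h2 h1]
  nlinarith [mul_nonneg hl0 (sub_nonneg.mpr hr1)]

/-- THE RELAXED SLACK IS AT MOST THE GAP TO THE CAP.  With `c = 1 − 2x s − 2𝒰(x)` and `2x̂ s + 2𝒰(x̂) = 1`:  `c = 2s(x̂ − x) + 2(𝒰(x̂) − 𝒰(x))`, so any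
secant bound `𝒰(x̂) − 𝒰(x) ≤ D'·(x̂ − x)` gives `c ≤ 2(s + D')(x̂ − x)` — a saturated age (`x → x̂`) has no slack left. [folklore] -/
theorem relaxed_slack_le_gap {𝒰 : ℝ → ℝ} {x xh s D' : ℝ} (hcap : 2 * xh * s + 2 * 𝒰 xh = 1) (hsec : 𝒰 xh - 𝒰 x ≤ D' * (xh - x)) :
    1 - 2 * x * s - 2 * 𝒰 x ≤ 2 * (s + D') * (xh - x) := by nlinarith

/-! ## §4 Per-age domination closes the step -/

/-- **PER-AGE DOMINATION SUMS.**  If every older age's chain term is dominated by `κ` times its amplified charge on the young's row, `θ_j b_j ≤ κ·d_j`, and the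
game's cap satisfies `2s·x̂ + x̂·Σ_j d_j ≤ 1` (`x̂ ≥ 0`), then **`x̂·Σ_j θ_j b_j ≤ κ·(1 − 2s·x̂)`**: the young's cap times the chain load it sees is at most `κ`
times the share of its row taken by the elders. [folklore] -/
theorem cap_mul_load_le_of_domination {n : ℕ} {θ b d : ℕ → ℝ} {κ s xh : ℝ} (hxh : 0 ≤ xh) (hκ : 0 ≤ κ)
    (hdom : ∀ j, j < n → θ j * b j ≤ κ * d j) (hcap : 2 * s * xh + xh * ∑ j ∈ range n, d j ≤ 1) :
    xh * ∑ j ∈ range n, θ j * b j ≤ κ * (1 - 2 * s * xh) := by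
  have h1 : ∑ j ∈ range n, θ j * b j ≤ κ * ∑ j ∈ range n, d j := by
    rw [mul_sum]; exact sum_le_sum fun j hj => hdom j (mem_range.mp hj)
  have h2 : xh * ∑ j ∈ range n, d j ≤ 1 - 2 * s * xh := by linarith
  calc xh * ∑ j ∈ range n, θ j * b j ≤ xh * (κ * ∑ j ∈ range n, d j) := mul_le_mul_of_nonneg_left h1 hxh
    _ = κ * (xh * ∑ j ∈ range n, d j) := by ring
    _ ≤ κ * (1 - 2 * s * xh) := mul_le_mul_of_nonneg_left h2 hκ

/-- **CLOSURE FROM THE CAP TIMES THE LOAD** ((E74a)'s window-mass form with the game's cap).  Young load `0 ≤ x ≤ x̂`, chain load `V ≥ 0`, older usage `U` of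
the young's row with `s·x + U ≤ ½` (`s > 0`), window mass `Ω ≤ c·U₀` with `U₀ ≤ U`, `0 ≤ c < 2`, `c·s ≤ 1` (the window-mass constants: `c = z∕S(z+1,z)`,
`c·s = S(z,z)∕S(z+1,z) ≤ 1`); if **`x̂·(V + (1 − c·s)) < 1 − c∕2`** then `ρ = x(1+V)∕(1−Ω) < 1`. [folklore] -/
theorem ratio_lt_one_of_cap_mul_load {x xh V U U0 Ω c s : ℝ} (hx : 0 ≤ x) (hxxh : x ≤ xh) (hV : 0 ≤ V) (hs : 0 < s)
    (hbudget : s * x + U ≤ 1 / 2) (hU0U : U0 ≤ U) (hΩ : Ω ≤ c * U0) (hc : 0 ≤ c) (hc2 : c < 2) (hcs : c * s ≤ 1)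
    (hcrit : xh * (V + (1 - c * s)) < 1 - c / 2) :
    x * (1 + V) / (1 - Ω) < 1 := by
  -- denominator: `1 − Ω ≥ 1 − cU ≥ (1 − c∕2) + c·s·x > 0`
  have hΩ' : Ω ≤ c * U := hΩ.trans (mul_le_mul_of_nonneg_left hU0U hc)
  have hden : (1 - c / 2) + c * s * x ≤ 1 - Ω := by nlinarith [mul_le_mul_of_nonneg_left hbudget hc]
  have hpos : 0 < (1 - c / 2) + c * s * x := by
    have : 0 ≤ c * s * x := by positivity
    linarith
  have h1Ω : 0 < 1 - Ω := lt_of_lt_of_le hpos hden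
  rw [div_lt_one h1Ω]
  -- numerator: `x(1+V) = x·(V + (1 − cs)) + c·s·x ≤ x̂·(V + (1 − cs)) + c·s·x < (1 − c∕2) + c·s·x ≤ 1 − Ω`
  have h2 : x * (V + (1 - c * s)) ≤ xh * (V + (1 - c * s)) :=
    mul_le_mul_of_nonneg_right hxxh (by linarith)
  nlinarith

/-- THE OWN TERM AGAINST THE OWN CHARGE (the two-age factor of README §5).  An older age with load `x > 0`, ratio `ρ = x·M < 1` (`M ≥ 0`), own carried ratio
`b = ρ∕(1−ρ)`, relaxed slack `c > 0`, defect `θ ≥ 0` at the young and amplified charge `d ≥ 4xψ∕c` on the young's row (`ψ = σ·φ` the product of its read on the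
young's row and the young's read on its row): **`θ·b ≤ [θ·c·M∕(4ψ(1−ρ))]·d`** (`ψ > 0`) — the per-age constant is `θcM∕(4ψ(1−ρ))`, i.e. `θ∕(4ψ)` times
«slack × multiplier ∕ (1 − ratio)» of the older age. [folklore] -/
theorem own_term_le_of_charge {θ x M c ψ d : ℝ} (hθ : 0 ≤ θ) (hx : 0 < x) (hM : 0 ≤ M) (hρ : x * M < 1) (hc : 0 < c) (hψ : 0 < ψ)
    (hd : 4 * x * ψ / c ≤ d) :
    θ * (x * M / (1 - x * M)) ≤ θ * c * M / (4 * ψ * (1 - x * M)) * d := by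
  have h1 : 0 < 1 - x * M := sub_pos.mpr hρ
  have hK : 0 ≤ θ * c * M / (4 * ψ * (1 - x * M)) := by positivity
  have h2 := mul_le_mul_of_nonneg_left hd hK
  refine le_trans (le_of_eq ?_) h2
  field_simp

/-- SLACK TIMES MULTIPLIER UNDER A TANGENT.  If the relaxed slack lies under a line, `c(x) ≤ c₀ − α·x`, whose slope dominates `α ≥ c₀·M` (`M ≥ 0`), then for
`x ≥ 0` with `x·M < 1`: `c(x)·M∕(1 − x·M) ≤ c₀·M` — the per-age constant of `own_term_le_of_charge` never exceeds its value at zero load, `c₀M = (1 − 2𝒰(0))·M`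
(README §5: the closure of the age's own step with the tangent cap). [folklore] -/
theorem slack_mul_le_of_tangent {cx c0 α x M : ℝ} (hM : 0 ≤ M) (hx : 0 ≤ x) (hρ : x * M < 1) (hcx : cx ≤ c0 - α * x) (hα : c0 * M ≤ α) :
    cx * M / (1 - x * M) ≤ c0 * M := by
  have h1 : 0 < 1 - x * M := sub_pos.mpr hρ
  rw [div_le_iff₀ h1]
  have h2 : cx * M ≤ (c0 - α * x) * M := mul_le_mul_of_nonneg_right hcx hM
  nlinarith [mul_le_mul_of_nonneg_right hα (mul_nonneg hx hM)]

/-! ## §5 (append, gen 68) The signed-sum criterion and the two regimes of a per-age term -/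

/-- **THE SIGNED-SUM CRITERION.**  With the game's cap `x̂ > 0`, `x̂·(2s + Σ_j d_j) = 1` (`d_j` the older ages' amplified charges per unit young load), the
window-mass constants `κ₀ = 1 − c∕2`, `τ = 1 − c·s`, and the chain terms `θ_j b_j`:  if **`Σ_j (θ_j b_j − κ₀ d_j) < 2s − 1`** then `x̂·(Σ_j θ_j b_j + τ) < κ₀` — the
hypothesis of `ratio_lt_one_of_cap_mul_load`.  Per-age domination (`θ_j b_j ≤ κ₀ d_j` for every `j`, `cap_mul_load_le_of_domination`) makes the left side `≤ 0`;
the criterion tolerates a total positive excess of `2s − 1 ≥ √2 − 1` (README §5: numerically the excess is `0` in every configuration found — every older age is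
dominated with `κ₀ ≥ 0.3876`, `max_j θ_j b_j ∕ d_j ≤ 0.35`). [folklore] -/
theorem cap_mul_load_lt_of_signed_sum {n : ℕ} {θ b d : ℕ → ℝ} {c s xh : ℝ} (hxh : 0 < xh)
    (hcap : xh * (2 * s + ∑ j ∈ range n, d j) = 1)
    (hsum : ∑ j ∈ range n, (θ j * b j - (1 - c / 2) * d j) < 2 * s - 1) :
    xh * (∑ j ∈ range n, θ j * b j + (1 - c * s)) < 1 - c / 2 := by
  have hsplit : ∑ j ∈ range n, (θ j * b j - (1 - c / 2) * d j) =
      ∑ j ∈ range n, θ j * b j - (1 - c / 2) * ∑ j ∈ range n, d j := by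
    rw [sum_sub_distrib, mul_sum]
  rw [hsplit] at hsum
  -- `Σθb + τ < (2s − 1) + κ₀ Σd + (1 − cs) = κ₀ (2s + Σd)`; multiply by `x̂ > 0` and use the cap identity
  have h1 : ∑ j ∈ range n, θ j * b j + (1 - c * s) < (1 - c / 2) * (2 * s + ∑ j ∈ range n, d j) := by nlinarith
  have h2 := mul_lt_mul_of_pos_left h1 hxh
  calc xh * (∑ j ∈ range n, θ j * b j + (1 - c * s)) < xh * ((1 - c / 2) * (2 * s + ∑ j ∈ range n, d j)) := h2
    _ = (1 - c / 2) * (xh * (2 * s + ∑ j ∈ range n, d j)) := by ring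
    _ = 1 - c / 2 := by rw [hcap, mul_one]

/-- THE CONSTANT REGIME OF A PER-AGE TERM.  The game's ratio bound is a maximum, `ĝ_j ≥ 1`, so the amplified charge per unit young load obeys `d_j = 2x_jσ_jĝ_j∕x̂ ≥
2x_jσ_j∕x̂`; hence `θ_j b_j ≤ κ·d_j` as soon as **`x̂·θ_j b_j ≤ 2κ x_j σ_j`** — the regime of an older age whose multiplier is large because IT is squeezed: then the
young below it is squeezed too (`x̂` small), and the term is dominated through the cap rather than through the slack (README §5 (ii); the linear regime
`ĝ_j ≥ 2x̂φ_j∕c_j` is `own_term_le_of_charge`). [folklore] -/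
theorem term_le_of_constant_regime {θb κ x σ gh xh d : ℝ} (hxh : 0 < xh) (hκ : 0 ≤ κ) (hx : 0 ≤ x) (hσ : 0 ≤ σ) (hgh : 1 ≤ gh)
    (hd : d = 2 * x * σ * gh / xh) (hreg : xh * θb ≤ 2 * κ * x * σ) : θb ≤ κ * d := by
  have h1 : 2 * x * σ / xh ≤ d := by
    rw [hd]
    exact div_le_div_of_nonneg_right (by nlinarith [mul_nonneg hx hσ]) hxh.le
  have h2 : θb ≤ κ * (2 * x * σ / xh) := by
    rw [← mul_div_assoc, le_div_iff₀ hxh]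
    linarith
  exact h2.trans (mul_le_mul_of_nonneg_left h1 hκ)

/-! ## §6 (append, gen 68) The slack quotient and the domination of unsqueezed elders -/

/-- **THE SLACK QUOTIENT IDENTITY.**  For a processed age write its relaxed slack as `c = 2(s + W̄)(x̂ − x)` (`W̄` the secant slope of the game usage `𝒰` between its load
`x` and its cap `x̂`: `c = 2s(x̂−x) + 2(𝒰(x̂) − 𝒰(x))` exactly), its multiplier as `M = ρ̂∕x̂` (`ρ̂ = x̂M` its ratio at full load) and `x = λx̂`; then
`c·M∕(1 − xM) = 2(s+W̄)·ρ̂·(1−λ)∕(1−λρ̂)` — «slack × multiplier ∕ (1 − ratio)» = `(ρ̂∕lone)(1 + W̄∕s)(1−λ)∕(1−λρ̂)` with `lone = 1∕(2s)`.  (README §5: this is the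
quantity `R̃` that per-age domination and `E ≤ G` need below `≈ 1.35`.) [folklore] -/
theorem slack_quotient_eq {c s W xh x lam M ρh : ℝ} (hxh : xh ≠ 0) (hc : c = 2 * (s + W) * (xh - x)) (hM : M = ρh / xh) (hx : x = lam * xh) :
    c * M / (1 - x * M) = 2 * (s + W) * ρh * (1 - lam) / (1 - lam * ρh) := by
  have e1 : x * M = lam * ρh := by rw [hx, hM]; field_simp
  have e2 : c * M = 2 * (s + W) * ρh * (1 - lam) := by rw [hc, hM, hx]; field_simp
  rw [e1, e2]

/-- **THE SLACK QUOTIENT IS AT MOST `(ρ̂∕lone)(1 + W̄∕s)`.**  With `0 ≤ λ < 1`, `ρ̂ ≤ 1`, `s + W̄ ≥ 0`, `ρ̂ ≥ 0`: `2(s+W̄)ρ̂(1−λ)∕(1−λρ̂) ≤ 2(s+W̄)ρ̂`; so under the induction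
hypothesis `ρ̂ ≤ (1+π)·lone` (README §3: `π ≤ 0.008`) an elder whose cap was set by PLAIN usage (`W̄ = 0`) has slack quotient `≤ 1 + π`. [folklore] -/
theorem slack_quotient_le {s W lam ρh : ℝ} (hsW : 0 ≤ s + W) (hρ0 : 0 ≤ ρh) (hρ1 : ρh ≤ 1) (hl0 : 0 ≤ lam) (hl1 : lam < 1) :
    2 * (s + W) * ρh * (1 - lam) / (1 - lam * ρh) ≤ 2 * (s + W) * ρh := by
  have h1 : 0 < 1 - lam * ρh := by nlinarith
  rw [div_le_iff₀ h1]
  have h2 : 0 ≤ 2 * (s + W) * ρh := by positivity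
  nlinarith [mul_nonneg h2 (mul_nonneg hl0 (sub_nonneg.mpr hρ1))]

/-- **UNSQUEEZED ELDERS ARE DOMINATED (linear regime).**  An older age `j` of the young with load `x ≥ 0`, multiplier `M ≥ 0`, ratio `xM < 1`, carried ratio
`b = (xM∕(1−xM))·E` with compounding `E ≤ G` by the nearer ages (`G ≥ 0`), relaxed slack `c > 0`, amplified charge `d ≥ 4xψG∕c` (`ψ > 0`), defect `θ ≥ 0`; if its slack
quotient is bounded, `cM∕(1−xM) ≤ Q`, and **`θ·Q ≤ 4κψ`** (i.e. `ω·Q ≤ κ` with `ω = θ∕(4ψ)`; README §5 table: `ω ≤ 0.2865`, so `Q ≤ 1.35` suffices for `κ = κ₀ ≥ 0.3876`),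
then **`θ·b ≤ κ·d`** — the per-age domination of `cap_mul_load_le_of_domination` ∕ `cap_mul_load_lt_of_signed_sum`.  With `slack_quotient_le`: every elder with
`(ρ̂∕lone)(1 + W̄∕s) ≤ 1.35` is dominated. [folklore] -/
theorem linear_regime_dominated {θ x M E G c ψ d Q κ b : ℝ} (hθ : 0 ≤ θ) (hx : 0 ≤ x) (hM : 0 ≤ M) (hρ : x * M < 1) (hEG : E ≤ G) (hG : 0 ≤ G)
    (hc : 0 < c) (hψ : 0 < ψ) (hb : b = x * M / (1 - x * M) * E) (hd : 4 * x * ψ * G / c ≤ d) (hQ : c * M / (1 - x * M) ≤ Q) (hκ : θ * Q ≤ 4 * κ * ψ) :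
    θ * b ≤ κ * d := by
  have h1 : 0 < 1 - x * M := sub_pos.mpr hρ
  have hxM : 0 ≤ x * M / (1 - x * M) := div_nonneg (mul_nonneg hx hM) h1.le
  -- `κ ≥ 0`: `0 ≤ θ·(cM∕(1−xM)) ≤ θQ ≤ 4κψ` with `ψ > 0`
  have hQ0 : 0 ≤ Q := le_trans (div_nonneg (mul_nonneg hc.le hM) h1.le) hQ
  have hk : 0 ≤ κ := by nlinarith [mul_nonneg hθ hQ0]
  -- `θ b ≤ θ (xM∕(1−xM)) G`
  have h2 : θ * b ≤ θ * (x * M / (1 - x * M) * G) := by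
    rw [hb]; exact mul_le_mul_of_nonneg_left (mul_le_mul_of_nonneg_left hEG hxM) hθ
  -- `xM∕(1−xM)·G = x·(M∕(1−xM))·G ≤ x·(Q∕c)·G`
  have hQ' : M / (1 - x * M) ≤ Q / c := by
    rw [le_div_iff₀ hc]
    calc M / (1 - x * M) * c = c * M / (1 - x * M) := by ring
      _ ≤ Q := hQ
  have h3 : x * M / (1 - x * M) * G ≤ x * (Q / c) * G := by
    have e : x * M / (1 - x * M) = x * (M / (1 - x * M)) := by ring
    rw [e]
    exact mul_le_mul_of_nonneg_right (mul_le_mul_of_nonneg_left hQ' hx) hG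
  -- `θ·x(Q∕c)G = (θQ)·(xG∕c) ≤ 4κψ·(xG∕c) = κ·(4xψG∕c) ≤ κ d`
  have hxGc : 0 ≤ x * G / c := div_nonneg (mul_nonneg hx hG) hc.le
  have h4 : θ * (x * (Q / c) * G) = (θ * Q) * (x * G / c) := by field_simp
  have h5 : (θ * Q) * (x * G / c) ≤ (4 * κ * ψ) * (x * G / c) := mul_le_mul_of_nonneg_right hκ hxGc
  have h6 : (4 * κ * ψ) * (x * G / c) = κ * (4 * x * ψ * G / c) := by field_simp
  calc θ * b ≤ θ * (x * M / (1 - x * M) * G) := h2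
    _ ≤ θ * (x * (Q / c) * G) := mul_le_mul_of_nonneg_left h3 hθ
    _ = (θ * Q) * (x * G / c) := h4
    _ ≤ (4 * κ * ψ) * (x * G / c) := h5
    _ = κ * (4 * x * ψ * G / c) := h6
    _ ≤ κ * d := mul_le_mul_of_nonneg_left hd hk

end Summit.QuantumFields.BalabanUV.Beta.EriceRemainderEnclosureHistoryAutonomyComparisonAgeCompositionStaticChainSaturation

end
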